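import Summits.QuantumFields.YangMills.Theorems.FlatTubeReductionDecimationSelection
import HarnessLib

/-!
# Route `FlatTubeReduction`, crux `PinnedUnitStepEx` (stmt-QuantumFields-27561), stub `stub_smearVarPosGS1` — E2a: run-shift invariance of a
# link set and the translate lemma for decoders

Seat ym-line-fcl-p3 g9 (2026-08-28).  Blueprint v2 file E2 (first part).
* `mem_iff_mem_shift_of_isContr` — if the `k`-slices `s` and `s+1` of a link set `F` are both contractible, membership in `F` is invariant under
  the unit shift `z ↦ z + e_k` of base points with `z_k = s` (for links of EVERY direction); `mem_iff_mem_shift_nat_of_isContr` — iterated along a run;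
* `decoded_eq_shiftLinks` — the TRANSLATE LEMMA: if `fineSupp v' R' = fineSupp 0 R` and, coordinate by coordinate, the two readings
  `thinSite x − v'` and `thinSite (x + m̄)` of every coarse site either agree or are joined by a run of contractible fine slices, then
  `R' = shiftLinks (−m̄) R` (i.e. `(x,i) ∈ R' ↔ (x + m̄, i) ∈ R`).  The final assembly discharges the hypothesis for trivial decoders
  (blueprint v2, E1b classification).
R2b1 RECORD rung; no summit/crux/stub here.
-/

set_option autoImplicit false

namespace Summit.QuantumFields.YangMills.Theorems.FlatTubeReduction.Decimation

open Finset Function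
open Literature.MathematicalPhysics.QuantumFieldTheory (Site Edge)
open Summit.QuantumFields.YangMills.Theorems.FemtoCutoffLadder.Thinning

/-- **Run-shift invariance**: if the `k`-slices `s` and `s + 1` of `F` are contractible then, for base points `z` with `z_k = s` and every direction
`i`, `(z, i) ∈ F ↔ (z + e_k, i) ∈ F`. [folklore] -/
theorem mem_iff_mem_shift_of_isContr {M : ℕ} {F : Finset (Edge 3 M)} {k : Fin 3} {s : ZMod M}
    (hs : IsContr k s F) (hs1 : IsContr k (s + 1) F) (z : Site 3 M) (hz : z k = s) (i : Fin 3) :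
    (z, i) ∈ F ↔ (z + Pi.single k 1, i) ∈ F := by
  by_cases hik : i = k
  · subst hik
    have h := hs1.2 (z + Pi.single i 1) (by simp [hz])
    rw [add_sub_cancel_right] at h
    exact h
  · constructor
    · intro h; exact absurd (hs.1 (z, i) h hz) hik
    · intro h; exact absurd (hs1.1 (z + Pi.single k 1, i) h (by simp [hz])) hik

/-- **Iterated run-shift invariance**: if the `k`-slices `s, s+1, …, s+n` of `F` are contractible then `(z, i) ∈ F ↔ (z + n·e_k, i) ∈ F` for
`z_k = s`. [folklore] -/
theorem mem_iff_mem_shift_nat_of_isContr {M : ℕ} {F : Finset (Edge 3 M)} {k : Fin 3} {s : ZMod M} {n : ℕ}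
    (hrun : ∀ t : ℕ, t ≤ n → IsContr k (s + (t : ZMod M)) F) (z : Site 3 M) (hz : z k = s) (i : Fin 3) :
    (z, i) ∈ F ↔ (z + Pi.single k ((n : ℕ) : ZMod M), i) ∈ F := by
  induction n with
  | zero => simp
  | succ n ih =>
    have ih' := ih (fun t ht => hrun t (by omega))
    rw [ih']
    have h1 : IsContr k (s + (n : ZMod M)) F := hrun n (by omega)
    have h2 : IsContr k (s + (n : ZMod M) + 1) F := by
      have := hrun (n + 1) le_rfl
      rwa [Nat.cast_succ, ← add_assoc] at this
    have h := mem_iff_mem_shift_of_isContr h1 h2 (z + Pi.single k ((n : ℕ) : ZMod M)) (by simp [hz]) i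
    rw [h, add_assoc, ← Pi.single_add, Nat.cast_succ]

variable {L' : ℕ} [NeZero L']

/-- **The translate lemma for decoders**: if `fineSupp (L'+1) v' R' = fineSupp (L'+1) 0 R` and for every coarse site `x` and coordinate `k` the two
fine readings `(thinSite x − v')_k` and `(thinSite (x + m̄))_k` either coincide or are joined by `n` upward unit steps through contractible
fine `k`-slices of the support, then `R'` is the translate of `R` by `−m̄`: `(x, i) ∈ R' ↔ (x + m̄, i) ∈ R`. [folklore] -/
theorem decoded_eq_shiftLinks {R R' : Finset (Edge 3 L')} {v' : Site 3 (L' + 1)} (hF : fineSupp (L' + 1) v' R' = fineSupp (L' + 1) 0 R)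
    (mbar : Site 3 L')
    (hstep : ∀ (x : Site 3 L') (k : Fin 3), ∃ n : ℕ,
      (thinSite (L' + 1) (x + mbar)) k = (thinSite (L' + 1) x - v') k + (n : ZMod (L' + 1)) ∧
        ∀ t : ℕ, t ≤ n → 0 < n → IsContr k ((thinSite (L' + 1) x - v') k + (t : ZMod (L' + 1))) (fineSupp (L' + 1) 0 R)) :
    R' = shiftLinks (-mbar) R := by
  ext ⟨x, i⟩
  rw [mem_shiftLinks_iff, sub_neg_eq_add, ← out_mem_fineSupp_iff v' R' x i, ← out_mem_fineSupp_iff 0 R (x + mbar) i, hF, sub_zero]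
  -- move the base point coordinate by coordinate
  set F := fineSupp (L' + 1) 0 R with hFdef
  set y := thinSite (L' + 1) x - v' with hy
  set y' := thinSite (L' + 1) (x + mbar) with hy'
  -- chain `y = y₀ → y₁ → y₂ → y₃ = y'`, changing coordinate `k` at step `k`
  have key : ∀ (k : ℕ) (hk : k ≤ 3), (y, i) ∈ F ↔
      ((fun k' : Fin 3 => if (k' : ℕ) < k then y' k' else y k'), i) ∈ F := by
    intro k hk
    induction k with
    | zero => simp
    | succ k ih =>
      rw [ih (by omega)]
      have hk3 : k < 3 := by omega
      set kf : Fin 3 := ⟨k, hk3⟩ with hkf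
      obtain ⟨n, hn, hcontr⟩ := hstep x kf
      set z : Site 3 (L' + 1) := fun k' : Fin 3 => if (k' : ℕ) < k then y' k' else y k' with hz
      have hzk : z kf = y kf := by simp [hz, hkf]
      have hnext : (fun k' : Fin 3 => if (k' : ℕ) < k + 1 then y' k' else y k') = z + Pi.single kf ((n : ℕ) : ZMod (L' + 1)) := by
        funext k'
        simp only [hz, Pi.add_apply, Pi.single_apply]
        by_cases h1 : (k' : ℕ) < k
        · have : k' ≠ kf := fun h => by rw [h, hkf] at h1; exact lt_irrefl _ h1
          simp [h1, Nat.lt_succ_of_lt h1, this]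
        · by_cases h2 : k' = kf
          · subst h2
            simp only [hkf, lt_irrefl, if_false, Nat.lt_succ_self, if_true]
            rw [← hkf]
            change thinSite (L' + 1) (x + mbar) kf = (thinSite (L' + 1) x - v') kf + (n : ZMod (L' + 1))
            exact hn
          · have h3 : ¬ (k' : ℕ) < k + 1 := fun h => by
              have : (k' : ℕ) = k := by omega
              exact h2 (Fin.ext this)
            simp [h1, h3, h2]
      rw [hnext]
      rcases Nat.eq_zero_or_pos n with hn0 | hnpos
      · subst hn0; simp
      · exact mem_iff_mem_shift_nat_of_isContr (s := y kf) (fun t ht => hcontr t ht hnpos) z hzk i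
  have h3 := key 3 le_rfl
  have hfin : (fun k' : Fin 3 => if (k' : ℕ) < 3 then y' k' else y k') = y' := funext fun k' => by simp [k'.isLt]
  rw [hfin] at h3
  exact h3

end Summit.QuantumFields.YangMills.Theorems.FlatTubeReduction.Decimation
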